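import Summits.Ventures.PackingBounds.Configurations.CL17Codes
import Summits.Ventures.PackingBounds.Configurations.CL18Vectors

/-!
# Ganzhinov's kissing configuration in dimension `14`, I: the `210` base vectors of `ℤ⁷` and their inner products

Framing: lottery ticket; floor = certified bounds/negative ranges. Venture `PackingBounds` (cell
`pub-packcert`, seat `pub-packcert-energy`).

Ganzhinov (*Highly symmetric lines*, §5.5) improves `κ(14) ≥ 1606` to **`κ(14) ≥ 1932`** with the spherical code
`Φ₃ ∪ (1+i)/√2 · Φ₂ ∪ (1−i)/√2 · Φ₂ ∪ Φ₄ ∪ i Φ₄ ⊂ ℂ⁷ = ℝ¹⁴`, where `Φ₂` is the (unit) root system `E₇` written as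
`9` cross-polytopes `B₀, …, B₈` (`B₀ = {±e_m}`, the others on the seven `4`-subsets of `{0,…,6}` complementary to the
lines of the Fano plane), `Φ₃ = {i^k (v + i w)/√2 : v ⊥ w in the same B_j}` (`1512` vectors) and `Φ₄` is the root
system `D₇` scaled to the unit sphere (`84`). Multiplying by `2√2` and writing `z = x + i y ∈ ℂ⁷` as `(x, y)`, every
vector becomes an INTEGER vector `(u, u′) ∈ ℤ⁷ × ℤ⁷` of norm `8` with `u, u′` among `210` base vectors of `ℤ⁷`:
the doubled `E₇` vectors (`126`, norm `4`: `±2 e_m` and `(±1)⁴` on a block) and the `D₇` vectors `(±2, ±2, 0⁵)`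
(`84`, norm `8`); the configuration is `{(u, u′) : u, u′ ∈ 2E₇ in the same frame}` (`9 · 14² = 1764` vectors: `Φ₃`
and `(1 ± i)/√2 · Φ₂`) together with `{(r, 0), (0, r) : r ∈ D₇}` (`168`), and kissing means `ip ≤ 4`.

This file indexes the base vectors by `t < 210` as pattern vectors `pvec (supp (gM t)) (bits of gS t) (gA t) 0` of
`CL17Vectors.lean` on the cells `0,…,6` (and a second copy on the cells `7,…,13`), gives the frame map `frameOf`
(affine-linear in the sign pattern; found by search — any partition of `E₇` into nine orthoplex frames would do),
expresses `ip` through the bit-count form `ipv`, and kernel-checks the five inner-product facts the construction needs: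
norms; distinct `E₇` vectors have `ip ≤ 2`; distinct vectors of one frame have `ip ≤ 0`; an `E₇` vector against a `D₇`
vector has `ip ≤ 4`; distinct `D₇` vectors have `ip ≤ 4`. The count `1932` and the transfer to `ℝ¹⁴`: `G14.lean`.

## References
* M. Ganzhinov, *Highly symmetric lines*, arXiv:2207.08266, §5.5 and Table 2; Linear Algebra Appl. 722 (2025) 12–37. [`Ganzhinov2022`]
-/

namespace Summit.Ventures.PackingBounds.Config.G14

open Finset Leech Golay CL17

/-! ### Tables -/

/-- Support masks of the seven `4`-subsets of `{0,…,6}` complementary to the lines `{m, m+1, m+3}` of the Fano plane (two blocks meet in two cells). -/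
def fanoC (i : ℕ) : ℕ :=
  match i with
  | 0 => 116 | 1 => 105 | 2 => 83 | 3 => 39 | 4 => 78 | 5 => 29 | 6 => 58
  | _ => 0
/-- Entry `4m + k`: the `k`-th cell of block `m` (spreads a `4`-bit sign pattern onto the block). -/
def fpos (i : ℕ) : ℕ :=
  match i with
  | 0 => 2 | 1 => 4 | 2 => 5 | 3 => 6 | 4 => 0 | 5 => 3 | 6 => 5 | 7 => 6 | 8 => 0 | 9 => 1 | 10 => 4 | 11 => 6
  | 12 => 0 | 13 => 1 | 14 => 2 | 15 => 5 | 16 => 1 | 17 => 2 | 18 => 3 | 19 => 6 | 20 => 0 | 21 => 2 | 22 => 3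
  | 23 => 4 | 24 => 1 | 25 => 3 | 26 => 4 | 27 => 5
  | _ => 0
/-- Frame of the all-plus vector on block `m` (the frame maps are affine-linear in the sign pattern). -/
def foff (i : ℕ) : ℕ :=
  match i with
  | 0 => 0 | 1 => 7 | 2 => 2 | 3 => 6 | 4 => 3 | 5 => 1 | 6 => 5
  | _ => 0
/-- Entry `4m + k`: the frame shift caused by a minus sign on the `k`-th cell of block `m` (linear part of the frame map). -/
def fimg (i : ℕ) : ℕ :=
  match i with
  | 0 => 1 | 1 => 2 | 2 => 4 | 3 => 7 | 4 => 1 | 5 => 3 | 6 => 7 | 7 => 5 | 8 => 5 | 9 => 4 | 10 => 7 | 11 => 6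
  | 12 => 2 | 13 => 5 | 14 => 6 | 15 => 1 | 16 => 6 | 17 => 7 | 18 => 2 | 19 => 3 | 20 => 3 | 21 => 2 | 22 => 4
  | 23 => 5 | 24 => 1 | 25 => 6 | 26 => 4 | 27 => 3
  | _ => 0
/-- Smaller cell of the `p`-th pair `{a < b} ⊆ {0,…,6}` (lexicographic order). -/
def pairLo (i : ℕ) : ℕ :=
  match i with
  | 0 => 0 | 1 => 0 | 2 => 0 | 3 => 0 | 4 => 0 | 5 => 0 | 6 => 1 | 7 => 1 | 8 => 1 | 9 => 1 | 10 => 1 | 11 => 2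
  | 12 => 2 | 13 => 2 | 14 => 2 | 15 => 3 | 16 => 3 | 17 => 3 | 18 => 4 | 19 => 4 | 20 => 5
  | _ => 0
/-- Larger cell of the `p`-th pair `{a < b} ⊆ {0,…,6}`. -/
def pairHi (i : ℕ) : ℕ :=
  match i with
  | 0 => 1 | 1 => 2 | 2 => 3 | 3 => 4 | 4 => 5 | 5 => 6 | 6 => 2 | 7 => 3 | 8 => 4 | 9 => 5 | 10 => 6 | 11 => 3
  | 12 => 4 | 13 => 5 | 14 => 6 | 15 => 4 | 16 => 5 | 17 => 6 | 18 => 5 | 19 => 6 | 20 => 6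
  | _ => 0

/-! ### The index functions (`t < 112`: `(±1)⁴` on block `t / 16` with sign pattern `t % 16`; `112 ≤ t < 126`: `±2 e_m`,
`m = (t - 112) / 2`; `126 ≤ t < 210`: `(±2, ±2)` on the pair `(t - 126) / 4` with signs `(t - 126) % 4`) -/

/-- Sign mask of the half vector on block `m` with `4`-bit sign pattern `σ`. -/
def spread (m σ : ℕ) : ℕ :=
  (if σ.testBit 0 then 2 ^ fpos (4 * m) else 0) + (if σ.testBit 1 then 2 ^ fpos (4 * m + 1) else 0) +
    (if σ.testBit 2 then 2 ^ fpos (4 * m + 2) else 0) + (if σ.testBit 3 then 2 ^ fpos (4 * m + 3) else 0)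

/-- Support mask of base vector `t`. -/
def gM (t : ℕ) : ℕ :=
  if t < 112 then fanoC (t / 16) else if t < 126 then 2 ^ ((t - 112) / 2)
  else 2 ^ pairLo ((t - 126) / 4) + 2 ^ pairHi ((t - 126) / 4)

/-- Sign mask (cells carrying a minus sign) of base vector `t`. -/
def gS (t : ℕ) : ℕ :=
  if t < 112 then spread (t / 16) (t % 16) else if t < 126 then (if (t - 112) % 2 = 1 then 2 ^ ((t - 112) / 2) else 0)
  else (if (t - 126) % 4 % 2 = 1 then 2 ^ pairLo ((t - 126) / 4) else 0) +
    (if 2 ≤ (t - 126) % 4 then 2 ^ pairHi ((t - 126) / 4) else 0)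

/-- Amplitude of base vector `t`: `1` on the half vectors, `2` on the axis and `D₇` vectors. -/
def gA (t : ℕ) : ℤ := if t < 112 then 1 else 2

/-- Frame of the `E₇` base vector `t < 126`: `foff m ⊕ (fimg over the minus signs)` for half vectors, `8` for axis vectors. -/
def frameOf (t : ℕ) : ℕ :=
  if t < 112 then
    foff (t / 16) ^^^ (if (t % 16).testBit 0 then fimg (4 * (t / 16)) else 0) ^^^
      (if (t % 16).testBit 1 then fimg (4 * (t / 16) + 1) else 0) ^^^ (if (t % 16).testBit 2 then fimg (4 * (t / 16) + 2) else 0) ^^^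
      (if (t % 16).testBit 3 then fimg (4 * (t / 16) + 3) else 0)
  else 8

/-- **Bit-count form of the inner product** of base vectors `t, t′`:
`gA t · gA t′ · (|M ∩ M′| − 2 |M ∩ M′ ∩ (S ⊕ S′)|)`. -/
def ipv (t t' : ℕ) : ℤ :=
  gA t * gA t' * ((popK 7 7 (gM t &&& gM t') : ℤ) - 2 * (popK 7 7 (gM t &&& gM t' &&& (gS t ^^^ gS t')) : ℤ))

/-- `ipv` is symmetric. -/
theorem ipv_comm (t t' : ℕ) : ipv t t' = ipv t' t := by
  unfold ipv
  rw [Nat.land_comm (gM t') (gM t), Nat.xor_comm (gS t') (gS t), mul_comm (gA t') (gA t)]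

/-! ### Kernel facts -/

/-- Masks are `7`-bit. -/
theorem gM_gS_lt : ∀ t < 210, gM t < 128 ∧ gS t < 128 := by decide +kernel

/-- Norms: `4` for the `E₇` vectors, `8` for the `D₇` vectors. -/
theorem ipv_self : ∀ t < 210, ipv t t = if t < 126 then 4 else 8 := by decide +kernel

/-- Support sizes: `4` cells (half vectors), `1` (axis vectors), `2` (`D₇` vectors). -/
theorem popK_gM : ∀ t < 210, popK 7 7 (gM t) = if t < 112 then 4 else if t < 126 then 1 else 2 := by decide +kernel

set_option maxRecDepth 100000 in
set_option maxHeartbeats 2000000 in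
/-- Distinct `E₇` vectors: `ip ≤ 2`; in the same frame: `ip ≤ 0` (`7875` pairs). -/
theorem ipv_E7_lt : ∀ t < 126, ∀ t' < t, ipv t t' ≤ 2 ∧ (frameOf t = frameOf t' → ipv t t' ≤ 0) := by decide +kernel

set_option maxRecDepth 100000 in
set_option maxHeartbeats 1000000 in
/-- Distinct `D₇` vectors: `ip ≤ 4` (`3486` pairs). -/
theorem ipv_D7_lt : ∀ e < 84, ∀ e' < e, ipv (126 + e) (126 + e') ≤ 4 := by decide +kernel

/-- On `7`-bit words the `24`-coordinate bit count is the `7`-coordinate one. -/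
theorem popK_24_eq_7 : ∀ c < 128, popK 24 24 c = popK 7 7 c := by decide +kernel

/-- Bit counts are unchanged by the shift to the second block of cells. -/
theorem popK_shiftLeft_seven : ∀ c < 128, popK 24 24 (c <<< 7) = popK 7 7 c := by decide +kernel

/-- `popK` is monotone under `AND` (right argument). -/
theorem popK_land_le_right (n a b : ℕ) : ∀ k, popK n k (a &&& b) ≤ popK n k b
  | 0 => le_rfl
  | k + 1 => by
    simp only [popK, Nat.testBit_and]
    have := popK_land_le_right n a b k
    cases a.testBit k <;> cases b.testBit k <;> simp <;> omega

/-- `popK` is monotone under `AND` (left argument). -/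
theorem popK_land_le_left (n a b k : ℕ) : popK n k (a &&& b) ≤ popK n k a := by
  rw [Nat.land_comm]; exact popK_land_le_right n b a k

/-- Distinct `E₇` vectors have `ipv ≤ 2` (symmetric form). -/
theorem ipv_le_two {t t' : ℕ} (ht : t < 126) (ht' : t' < 126) (hne : t ≠ t') : ipv t t' ≤ 2 := by
  rcases Nat.lt_or_gt_of_ne hne with h | h
  · rw [ipv_comm]; exact (ipv_E7_lt t' ht' t h).1
  · exact (ipv_E7_lt t ht t' h).1

/-- Distinct `E₇` vectors of one frame have `ipv ≤ 0` (symmetric form). -/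
theorem ipv_le_zero {t t' : ℕ} (ht : t < 126) (ht' : t' < 126) (hne : t ≠ t') (hf : frameOf t = frameOf t') :
    ipv t t' ≤ 0 := by
  rcases Nat.lt_or_gt_of_ne hne with h | h
  · rw [ipv_comm]; exact (ipv_E7_lt t' ht' t h).2 hf.symm
  · exact (ipv_E7_lt t ht t' h).2 hf

/-- Any two `E₇` vectors have `ipv ≤ 4`. -/
theorem ipv_le_four {t t' : ℕ} (ht : t < 126) (ht' : t' < 126) : ipv t t' ≤ 4 := by
  by_cases h : t = t'
  · subst h; rw [ipv_self t (by omega), if_pos ht]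
  · exact (ipv_le_two ht ht' h).trans (by norm_num)

/-- An `E₇` vector against a `D₇` vector: `ipv ≤ 4` — the common support has at most `min (|M|, 2)` cells. -/
theorem ipv_E7_D7_le {t d : ℕ} (ht : t < 126) (hd : 126 ≤ d) (hd' : d < 210) : ipv t d ≤ 4 := by
  have h0 : (0 : ℤ) ≤ (popK 7 7 (gM t &&& gM d &&& (gS t ^^^ gS d)) : ℤ) := Nat.cast_nonneg _
  have h1 : (popK 7 7 (gM t &&& gM d) : ℤ) ≤ (popK 7 7 (gM d) : ℤ) := by exact_mod_cast popK_land_le_right 7 _ _ 7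
  have h2 : (popK 7 7 (gM t &&& gM d) : ℤ) ≤ (popK 7 7 (gM t) : ℤ) := by exact_mod_cast popK_land_le_left 7 _ _ 7
  have hMd := popK_gM d hd'
  rw [if_neg (by omega), if_neg (by omega)] at hMd
  rw [hMd] at h1
  have hAd : gA d = 2 := by simp [gA]; omega
  unfold ipv
  rw [hAd]
  by_cases h : t < 112
  · have hAt : gA t = 1 := by simp [gA, h]
    rw [hAt]; push_cast at h1 ⊢; linarith
  · have hMt := popK_gM t (by omega)
    rw [if_neg h, if_pos ht] at hMt
    rw [hMt] at h2
    have hAt : gA t = 2 := by simp [gA, h]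
    rw [hAt]; push_cast at h2 ⊢; linarith

/-- Distinct `D₇` vectors (symmetric form). -/
theorem ipv_D7_le {d d' : ℕ} (hd : 126 ≤ d) (hdl : d < 210) (hd' : 126 ≤ d') (hdl' : d' < 210) (hne : d ≠ d') :
    ipv d d' ≤ 4 := by
  rcases Nat.lt_or_gt_of_ne hne with h | h
  · have := ipv_D7_lt (d' - 126) (by omega) (d - 126) (by omega)
    rwa [show 126 + (d' - 126) = d' by omega, show 126 + (d - 126) = d by omega, ipv_comm] at this
  · have := ipv_D7_lt (d - 126) (by omega) (d' - 126) (by omega)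
    rwa [show 126 + (d - 126) = d by omega, show 126 + (d' - 126) = d' by omega] at this

/-! ### Pattern vectors from masks and the bridge to `ipv` -/

/-- The pattern vector with support mask `M`, minus-sign mask `S` and amplitude `a` (no axis part). -/
def pv (M S : ℕ) (a : ℤ) : Fin 24 → ℤ := pvec (supp M) (fun j => S.testBit j.val) a 0

/-- A `14`-bit mask is supported on cells. -/
theorem supp_sub_cells_of_lt {M : ℕ} (hM : M < 2 ^ 14) : supp M ⊆ cells := fun j hj => by
  rw [mem_cells]
  by_contra h
  have h2 : 2 ^ 14 ≤ 2 ^ j.val := Nat.pow_le_pow_right (by norm_num) (by omega)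
  have := Nat.testBit_eq_false_of_lt (lt_of_lt_of_le hM h2)
  simp [supp, this] at hj

/-- **Bridge.** The inner product of two mask pattern vectors is the bit-count expression. -/
theorem ip_pv_pv {M M' : ℕ} (hM : M < 2 ^ 14) (hM' : M' < 2 ^ 14) (S S' : ℕ) (a a' : ℤ) :
    ip (pv M S a) (pv M' S' a') =
      a * a' * ((popK 24 24 (M &&& M') : ℤ) - 2 * (popK 24 24 (M &&& M' &&& (S ^^^ S')) : ℤ)) := by
  rw [pv, pv, ip_pvec_pvec (supp_sub_cells_of_lt hM) (supp_sub_cells_of_lt hM'), card_supp_inter]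
  have h : ((supp M ∩ supp M').filter fun j : Fin 24 => (S.testBit j.val ^^ S'.testBit j.val) = true) =
      supp (M &&& M' &&& (S ^^^ S')) := by
    ext j; simp [supp, Nat.testBit_xor]
  rw [h, show (supp (M &&& M' &&& (S ^^^ S'))).card = wt (M &&& M' &&& (S ^^^ S')) from rfl, wt_eq_popK]
  ring

/-- A mask pattern vector vanishes off its support mask. -/
theorem pv_apply_eq_zero {M S : ℕ} {a : ℤ} {j : Fin 24} (hj : M.testBit j.val = false) : pv M S a j = 0 := by
  have h : j ∉ supp M := by simp [supp, hj]
  simp [pv, pvec, h]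

/-! ### The base vectors on the two blocks of cells -/

/-- Base vector `t` on the cells `0,…,6`. -/
def vec (t : ℕ) : Fin 24 → ℤ := pv (gM t) (gS t) (gA t)

/-- Base vector `t` on the cells `7,…,13` (masks shifted by `7`). -/
def vec' (t : ℕ) : Fin 24 → ℤ := pv (gM t <<< 7) (gS t <<< 7) (gA t)

/-- A `7`-bit mask is a `14`-bit mask. -/
theorem lt14_of_lt7 {c : ℕ} (h : c < 128) : c < 2 ^ 14 := by omega

/-- A shifted `7`-bit mask is a `14`-bit mask. -/
theorem shift_lt14 {c : ℕ} (h : c < 128) : c <<< 7 < 2 ^ 14 := by rw [Nat.shiftLeft_eq]; omega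

/-- A `7`-bit mask and a shifted mask are disjoint. -/
theorem land_shift_eq_zero {a b : ℕ} (ha : a < 128) : a &&& (b <<< 7) = 0 := by
  apply Nat.eq_of_testBit_eq; intro i
  rw [Nat.testBit_and, Nat.zero_testBit, Nat.testBit_shiftLeft]
  by_cases hi : 7 ≤ i
  · have : a < 2 ^ i := lt_of_lt_of_le ha (by simpa using Nat.pow_le_pow_right (by norm_num : 0 < 2) hi)
    rw [Nat.testBit_eq_false_of_lt this]; rfl
  · simp [hi]

/-- Masks built by `AND` from a `7`-bit mask are `7`-bit. -/
theorem land_lt {a : ℕ} (b : ℕ) (ha : a < 128) : a &&& b < 128 := lt_of_le_of_lt Nat.and_le_left ha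

/-- **`ip (vec t) (vec t′) = ipv t t′`.** -/
theorem ip_vec_vec {t t' : ℕ} (ht : t < 210) (ht' : t' < 210) : ip (vec t) (vec t') = ipv t t' := by
  have hM := (gM_gS_lt t ht).1
  rw [vec, vec, ip_pv_pv (lt14_of_lt7 hM) (lt14_of_lt7 (gM_gS_lt t' ht').1), ipv,
    popK_24_eq_7 _ (land_lt _ hM), popK_24_eq_7 _ (land_lt _ (land_lt _ hM))]

/-- **`ip (vec′ t) (vec′ t′) = ipv t t′`.** -/
theorem ip_vec'_vec' {t t' : ℕ} (ht : t < 210) (ht' : t' < 210) : ip (vec' t) (vec' t') = ipv t t' := by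
  obtain ⟨hM, -⟩ := gM_gS_lt t ht
  obtain ⟨hM', -⟩ := gM_gS_lt t' ht'
  rw [vec', vec', ip_pv_pv (shift_lt14 hM) (shift_lt14 hM'), ipv, ← Nat.shiftLeft_and_distrib, ← Nat.shiftLeft_xor_distrib,
    ← Nat.shiftLeft_and_distrib, popK_shiftLeft_seven _ (land_lt _ hM), popK_shiftLeft_seven _ (land_lt _ (land_lt _ hM))]

/-- **The two blocks are orthogonal:** `ip (vec t) (vec′ t′) = 0`. -/
theorem ip_vec_vec' {t t' : ℕ} (ht : t < 210) (ht' : t' < 210) : ip (vec t) (vec' t') = 0 := by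
  obtain ⟨hM, -⟩ := gM_gS_lt t ht
  obtain ⟨hM', -⟩ := gM_gS_lt t' ht'
  rw [vec, vec', ip_pv_pv (lt14_of_lt7 hM) (shift_lt14 hM'), land_shift_eq_zero hM, Nat.zero_and]
  simp [popK]

/-- `ip (vec′ t) (vec t′) = 0`. -/
theorem ip_vec'_vec {t t' : ℕ} (ht : t < 210) (ht' : t' < 210) : ip (vec' t) (vec t') = 0 := by
  rw [ip_comm, ip_vec_vec' ht' ht]

/-- Base vectors vanish beyond cell `13` (first block: beyond cell `6`). -/
theorem vec_apply_eq_zero {t : ℕ} (ht : t < 210) {j : Fin 24} (hj : 14 ≤ j.val) : vec t j = 0 ∧ vec' t j = 0 := by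
  obtain ⟨hM, -⟩ := gM_gS_lt t ht
  have h2 : 2 ^ 14 ≤ 2 ^ j.val := Nat.pow_le_pow_right (by norm_num) hj
  exact ⟨pv_apply_eq_zero (Nat.testBit_eq_false_of_lt (lt_of_lt_of_le (lt14_of_lt7 hM) h2)),
    pv_apply_eq_zero (Nat.testBit_eq_false_of_lt (lt_of_lt_of_le (shift_lt14 hM) h2))⟩

end Summit.Ventures.PackingBounds.Config.G14
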